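import Mathlib
import HarnessLib
import Literature.Geometry.Lorentzian.KerrConvergence
import Literature.Geometry.Lorentzian.BondiMomentumCD
import Literature.Geometry.Lorentzian.StronglyAsymptoticallyFlatADMEnergy
import Summits.FinalStateConjecture.Statement

/-!
# Route MergerLatticeBudget — support item `RestMassBudget` (stmt-FinalStateConjecture-10235):
# the arithmetic link and the reduction to the Bondi four-momentum budget

The item reads: for every admissible datum `D`, every end `e` on which `D` is DR-strongly
asymptotically flat with mass parameter `Madm`, every maximal vacuum Cauchy development `𝒟` with
complete `𝓘⁺`, and every `C²` final-state decomposition `d` of `O = exteriorOf 𝒟 d.charted` with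
exhaustive charts, `∑ᵢ d.mass i ≤ Madm`. Its docstring chain is
`Σ Mⱼ ≤ |Σ Mⱼ uⱼ|_η = final Bondi rest mass ≤ M_ADM`.

This file lands the two kernel-checkable pieces of that chain, against the tree's vocabulary:

* `RestMassBudget.sum_le_configurationRestMass` — **the arithmetic link**: for orthochronous
  Lorentz motions `Λᵢ` and masses `Mᵢ ≥ 0`, the configuration four-momentum
  `P = ∑ᵢ Mᵢ Λᵢ e₀` satisfies `(∑ᵢ Mᵢ)² ≤ −η(P, P)`, i.e. `∑ᵢ Mᵢ ≤ √(−η(P, P))` (reverse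
  Cauchy–Schwarz for future unit timelike vectors, summed). The right-hand side is literally the
  quantity `V` of the crux `LeafBudgetLawsR` (clause (v)), so this is also the bridge from a cut-energy
  lower bound `V − δ ≤ m` to `∑ Mᵢ − δ ≤ m`.
* `RestMassBudget.of_bondiFrame` — **the reduction**: the item follows, by the proved consequences
  of `CauchyDevelopment.BondiFrameFoliation.IsCanonical` (`BondiMomentumCD.lean`:
  `finalBondiRestMass_le_admMass`, `bondiEnergy_nonneg`, `bondiEnergy_le_admEnergy`), from two
  inputs stated as binder hypotheses (NOT as named facts — neither is a theorem of the tree):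
  (H_adm) the DR mass parameter is the ADM energy, `IsStronglyAsymptoticallyFlatDR e D M →
  HasADMEnergy e D M` (true and provable-in-principle: the flux of `(1 + 2M/r)δ` through `S_r` is `M`,
  the `o₂(r⁻¹)` remainder contributes `o(1)`); (H_frame) card K1 proper: every such `𝒟` carries a
  Bondi frame foliation canonical for `e` whose final Bondi rest mass dominates `∑ᵢ d.mass i` for
  every exhaustive `C²` decomposition `d` (conjecture-strength: existence of the canonical foliation
  on a general complete-`𝓘⁺` MGHD and "no energy parked between the zones").
  The conclusion is the body of the route decl `RestMassBudget` written out verbatim (this file does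
  not import the route module, so that it can never close an import cycle with it).

Nothing here closes the item: as filed, `RestMassBudget` contains the positive-mass theorem (its
`N = 0` instance is `0 ≤ Madm` for every admissible datum with a dispersing complete-`𝓘⁺` MGHD) and
the Bondi four-momentum budget of the final-state picture (its `N ≥ 1` content), neither of which is
a theorem over `CauchyDevelopment` in the tree (the Bondi laws are the hypothesis structure
`IsCanonical`; the positive-mass theorems of `MassInequalities.lean` are named facts).
-/

noncomputable section

namespace Summit.FinalStateConjecture.FinalStateConjecture.Theorems

open Literature.Geometry.Lorentzian
open scoped BigOperators Manifold ContDiff Topology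

namespace RestMassBudget

/-! ### Reverse Cauchy–Schwarz in `(E4, η)` and the configuration rest mass -/

/-- **Reverse Cauchy–Schwarz inequality** for future unit timelike vectors of Minkowski space
`(E4, η)`, `η = −dt² + ∑ dxⁱ²`: if `η(u,u) = η(v,v) = −1` and `u⁰, v⁰ > 0` then `−η(u,v) ≥ 1`.
Proof: `(u⁰v⁰)² = (1 + |u̲|²)(1 + |v̲|²) ≥ (1 + u̲·v̲)²` by Cauchy–Schwarz and
`|u̲|² + |v̲|² ≥ 2 u̲·v̲`. O'Neill 1983, Ch. 5, Prop. 5.30. [cite: ONeill1983, Ch. 5, Prop. 5.30] -/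
theorem one_le_neg_bilin_of_unit_future {u v : E4}
    (hu : Minkowski.bilin u u = -1) (hv : Minkowski.bilin v v = -1)
    (hu0 : 0 < u 0) (hv0 : 0 < v 0) : 1 ≤ -Minkowski.bilin u v := by
  -- spatial Gram data
  set A : ℝ := ∑ i : Fin 3, u i.succ * u i.succ with hA
  set B : ℝ := ∑ i : Fin 3, v i.succ * v i.succ with hB
  set s : ℝ := ∑ i : Fin 3, u i.succ * v i.succ with hs
  have hu' : u 0 * u 0 = 1 + A := by
    have h := hu
    rw [Minkowski.bilin_apply] at h
    linarith
  have hv' : v 0 * v 0 = 1 + B := by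
    have h := hv
    rw [Minkowski.bilin_apply] at h
    linarith
  have hA0 : 0 ≤ A := Finset.sum_nonneg fun i _ ↦ mul_self_nonneg _
  have hB0 : 0 ≤ B := Finset.sum_nonneg fun i _ ↦ mul_self_nonneg _
  -- Cauchy–Schwarz: s² ≤ A B
  have hCS : s ^ 2 ≤ A * B := by
    have h := Finset.sum_mul_sq_le_sq_mul_sq Finset.univ (fun i : Fin 3 ↦ u i.succ)
      (fun i : Fin 3 ↦ v i.succ)
    simpa only [hA, hB, hs, pow_two] using h
  -- AM–GM: 2 s ≤ A + B
  have hAM : 2 * s ≤ A + B := by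
    have h : 0 ≤ ∑ i : Fin 3, (u i.succ - v i.succ) * (u i.succ - v i.succ) :=
      Finset.sum_nonneg fun i _ ↦ mul_self_nonneg _
    have hexp : ∑ i : Fin 3, (u i.succ - v i.succ) * (u i.succ - v i.succ) = A + B - 2 * s := by
      simp only [hA, hB, hs, Finset.mul_sum, ← Finset.sum_add_distrib, ← Finset.sum_sub_distrib]
      exact Finset.sum_congr rfl fun i _ ↦ by ring
    linarith
  have key : (1 + s) ^ 2 ≤ (u 0 * v 0) ^ 2 := by
    have h1 : (u 0 * v 0) ^ 2 = (1 + A) * (1 + B) := by rw [mul_pow, sq, sq, hu', hv']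
    rw [h1]
    nlinarith [hCS, hAM, hA0, hB0]
  have hpos : 0 ≤ u 0 * v 0 := (mul_pos hu0 hv0).le
  have hle : 1 + s ≤ u 0 * v 0 := (abs_le_of_sq_le_sq' key hpos).2
  rw [Minkowski.bilin_apply]
  linarith

/-- **The configuration rest mass dominates the sum of the rest masses**: for masses `Mᵢ ≥ 0` and
future unit timelike `uᵢ` (`η(uᵢ,uᵢ) = −1`, `uᵢ⁰ > 0`), the four-momentum `P = ∑ᵢ Mᵢ uᵢ` has
`(∑ᵢ Mᵢ)² ≤ −η(P, P)`. Bilinear expansion and `one_le_neg_bilin_of_unit_future` termwise (reverse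
triangle inequality for future causal vectors). O'Neill 1983, Ch. 5, Prop. 5.30 and Cor. 5.31.
[cite: ONeill1983, Ch. 5, Prop. 5.30] -/
theorem sq_sum_le_neg_bilin_sum {N : ℕ} (M : Fin N → ℝ) (u : Fin N → E4)
    (hM : ∀ i, 0 ≤ M i) (hu : ∀ i, Minkowski.bilin (u i) (u i) = -1) (hu0 : ∀ i, 0 < u i 0) :
    (∑ i, M i) ^ 2 ≤ -Minkowski.bilin (∑ i, M i • u i) (∑ i, M i • u i) := by
  have expand : Minkowski.bilin (∑ i, M i • u i) (∑ j, M j • u j) =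
      ∑ i, ∑ j, M i * M j * Minkowski.bilin (u i) (u j) := by
    rw [map_sum Minkowski.bilin, sum_apply]
    refine Finset.sum_congr rfl fun i _ ↦ ?_
    rw [map_smul, smul_apply, map_sum, smul_eq_mul, Finset.mul_sum]
    refine Finset.sum_congr rfl fun j _ ↦ ?_
    rw [map_smul, smul_eq_mul]
    ring
  rw [expand, sq, Finset.sum_mul_sum, ← Finset.sum_neg_distrib]
  refine Finset.sum_le_sum fun i _ ↦ ?_
  rw [← Finset.sum_neg_distrib]
  refine Finset.sum_le_sum fun j _ ↦ ?_
  have hij := one_le_neg_bilin_of_unit_future (hu i) (hu j) (hu0 i) (hu0 j)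
  nlinarith [mul_nonneg (hM i) (hM j), hij]

/-- A Lorentz transformation maps `e₀ = ∂ₜ` to a unit timelike vector: `η(Λe₀, Λe₀) = −1`.
O'Neill 1983, Ch. 9, p. 233. [cite: ONeill1983, Ch. 9, p. 233] -/
theorem bilin_lorentz_basisVector_zero (Λ : lorentzGroup) :
    Minkowski.bilin ((Λ : E4 ≃L[ℝ] E4) (EuclideanSpace.single 0 1))
      ((Λ : E4 ≃L[ℝ] E4) (EuclideanSpace.single 0 1)) = -1 := by
  rw [mem_lorentzGroup_iff.mp Λ.2]
  exact Minkowski.bilin_basisVector_zero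

/-- **`∑ Mᵢ ≤ V`, the arithmetic link of the rest-mass budget** (and of `LeafBudgetLawsR`, clause (v)):
for motions `(Λᵢ, cᵢ)` with `Λᵢ` orthochronous (`(Λᵢe₀)⁰ > 0`) and masses `Mᵢ ≥ 0`,
`∑ᵢ Mᵢ ≤ √(−η(P, P))` with `P = ∑ᵢ Mᵢ Λᵢ e₀` the configuration four-momentum — the right-hand
side being verbatim the `V` of `LeafBudgetLawsR`. Reverse triangle inequality for future causal
vectors. O'Neill 1983, Ch. 5, Cor. 5.31. [cite: ONeill1983, Ch. 5, Cor. 5.31] -/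
theorem sum_le_configurationRestMass {N : ℕ} (M : Fin N → ℝ) (mo : Fin N → lorentzGroup × E4)
    (hM : ∀ i, 0 ≤ M i)
    (hmo : ∀ i, 0 < ((mo i).1 : E4 ≃L[ℝ] E4) (EuclideanSpace.single 0 1) 0) :
    ∑ i, M i ≤ Real.sqrt (-(Minkowski.bilin
      (∑ i, M i • ((mo i).1 : E4 ≃L[ℝ] E4) (EuclideanSpace.single 0 1))
      (∑ i, M i • ((mo i).1 : E4 ≃L[ℝ] E4) (EuclideanSpace.single 0 1)))) := by
  have h := sq_sum_le_neg_bilin_sum M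
    (fun i ↦ ((mo i).1 : E4 ≃L[ℝ] E4) (EuclideanSpace.single 0 1)) hM
    (fun i ↦ bilin_lorentz_basisVector_zero (mo i).1) hmo
  calc ∑ i, M i = Real.sqrt ((∑ i, M i) ^ 2) :=
      (Real.sqrt_sq (Finset.sum_nonneg fun i _ ↦ hM i)).symm
    _ ≤ _ := Real.sqrt_le_sqrt h

/-! ### The reduction of the item to the Bondi four-momentum budget -/

/-- With a canonical Bondi frame foliation the ADM mass is at most the ADM energy,
`m_ADM = √(E² − |P|²) ≤ E` (the canonical foliation makes `E_ADM ≥ 0`: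
`bondiEnergy_nonneg`, `bondiEnergy_le_admEnergy`). Wald 1984, §11.2, (11.2.16).
[cite: Wald1984, §11.2 (11.2.16)] -/
theorem admMass_le_admEnergy_of_isCanonical {X : Type} [TopologicalSpace X] [ChartedSpace E3 X]
    [IsManifold (𝓡 3) ∞ X] [ConnectedSpace X] {D : InitialDataSet (𝓡 3) X}
    {𝒟 : CauchyDevelopment D} {𝓕 : 𝒟.BondiFrameFoliation} {e : AFEnd X}
    (hc : 𝓕.IsCanonical e) : AFEnd.admMass e D ≤ AFEnd.admEnergy e D := by
  have hE : 0 ≤ AFEnd.admEnergy e D :=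
    (hc.bondiEnergy_nonneg 0).trans (hc.bondiEnergy_le_admEnergy 0)
  rw [AFEnd.admMass]
  calc Real.sqrt (AFEnd.admEnergy e D ^ 2 - ∑ i : Fin 3, AFEnd.admMomentum e D i ^ 2)
      ≤ Real.sqrt (AFEnd.admEnergy e D ^ 2) :=
        Real.sqrt_le_sqrt (sub_le_self _ (Finset.sum_nonneg fun i _ ↦ sq_nonneg _))
    _ = AFEnd.admEnergy e D := Real.sqrt_sq hE

/-- **Reduction of `RestMassBudget` to the Bondi four-momentum budget** (card K1 of the route, in the
vocabulary of `BondiMomentumCD.lean`). The conclusion is the body of the route decl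
`Summit.FinalStateConjecture.FinalStateConjecture.Theses.MergerLatticeBudget.RestMassBudget`, verbatim
(so this type `δ`-unfolds to `H_adm → H_frame → RestMassBudget`). The two binder hypotheses are the
inputs the item needs beyond the tree and are NOT theorems of the tree:
* `hadm` — the DR mass parameter is the ADM energy of the end (`h = (1 + 2M/r)δ + o₂(r⁻¹)` has ADM
  energy flux `→ M`; Bartnik 1986, (4.2); Dafermos–Rodnianski 2013, App. B.2.3);
* `hframe` — every maximal vacuum Cauchy development with complete `𝓘⁺` of an admissible datum carries
  a Bondi frame foliation canonical for the end (`IsCanonical`: convergence of Hawking energies and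
  momenta along the cones, four-momentum loss, positivity, agreement with ADM at `u → −∞`) whose final
  Bondi rest mass dominates `∑ᵢ d.mass i` for every exhaustive `C²` final-state decomposition `d`
  ("the Bondi limit is the configuration four-momentum; no energy is parked between the zones").
Given these: `∑ᵢ Mᵢ ≤ M_B(+∞) ≤ m_ADM ≤ E_ADM = Madm` (`finalBondiRestMass_le_admMass`,
`admMass_le_admEnergy_of_isCanonical`, `HasADMEnergy.admEnergy_eq`). Ashtekar–Magnon-Ashtekar 1979;
Wald 1984, §11.2. [cite: AshtekarMagnonAshtekar1979] [cite: Wald1984, §11.2] -/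
theorem of_bondiFrame
    (hadm : ∀ (X : Type) [TopologicalSpace X] [ChartedSpace E3 X]
      [IsManifold (𝓡 3) ((⊤ : ℕ∞) : WithTop ℕ∞) X] [T2Space X] [SecondCountableTopology X]
      [ConnectedSpace X], ∀ D ∈ admissibleVacuumData X, ∀ (e : AFEnd X) (Madm : ℝ),
      e.IsStronglyAsymptoticallyFlatDR D Madm → AFEnd.HasADMEnergy e D Madm)
    (hframe : ∀ (X : Type) [TopologicalSpace X] [ChartedSpace E3 X]
      [IsManifold (𝓡 3) ((⊤ : ℕ∞) : WithTop ℕ∞) X] [T2Space X] [SecondCountableTopology X]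
      [ConnectedSpace X], ∀ D ∈ admissibleVacuumData X, ∀ (e : AFEnd X) (Madm : ℝ),
      e.IsStronglyAsymptoticallyFlatDR D Madm → ∀ 𝒟 : VacuumCauchyDevelopment D, 𝒟.IsMaximal →
      Summit.FinalStateConjecture.HasCompleteNullInfinity 𝒟.toCauchyDevelopment →
      ∀ (O : Set 𝒟.carrier) (d : FinalStateDecomposition 𝒟.toSpacetime O 2),
      O = Summit.FinalStateConjecture.exteriorOf 𝒟.toCauchyDevelopment d.charted →
      Summit.FinalStateConjecture.HasExhaustiveCharts d →
      ∃ 𝓕 : 𝒟.toCauchyDevelopment.BondiFrameFoliation,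
        𝓕.IsCanonical e ∧ ∑ i, d.mass i ≤ 𝓕.finalBondiRestMass) :
    ∀ (X : Type) [TopologicalSpace X] [ChartedSpace E3 X] [IsManifold (𝓡 3) ((⊤ : ℕ∞) : WithTop ℕ∞) X] [T2Space X] [SecondCountableTopology X] [ConnectedSpace X], ∀ D ∈ admissibleVacuumData X, ∀ (e : AFEnd X) (Madm : ℝ), e.IsStronglyAsymptoticallyFlatDR D Madm → ∀ 𝒟 : VacuumCauchyDevelopment D, 𝒟.IsMaximal → Summit.FinalStateConjecture.HasCompleteNullInfinity 𝒟.toCauchyDevelopment → ∀ (O : Set 𝒟.carrier) (d : FinalStateDecomposition 𝒟.toSpacetime O 2), O = Summit.FinalStateConjecture.exteriorOf 𝒟.toCauchyDevelopment d.charted → Summit.FinalStateConjecture.HasExhaustiveCharts d → ∑ i, d.mass i ≤ Madm := by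
  intro X _ _ _ _ _ _ D hD e Madm hSAF 𝒟 hmax hscri O d hO hex
  obtain ⟨𝓕, hc, hle⟩ := hframe X D hD e Madm hSAF 𝒟 hmax hscri O d hO hex
  calc ∑ i, d.mass i ≤ 𝓕.finalBondiRestMass := hle
    _ ≤ AFEnd.admMass e D := hc.finalBondiRestMass_le_admMass
    _ ≤ AFEnd.admEnergy e D := admMass_le_admEnergy_of_isCanonical hc
    _ = Madm := (hadm X D hD e Madm hSAF).admEnergy_eq

/-- **`RestMassBudget` from the Bondi four-momentum budget alone** (card K1): the input `hadm` of
`of_bondiFrame` — the DR mass parameter is the ADM energy — is the theorem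
`AFEnd.IsStronglyAsymptoticallyFlatDR.hasADMEnergy` (`StronglyAsymptoticallyFlatADMEnergy.lean`), so
the item reduces to the single binder hypothesis `hframe`: every maximal vacuum Cauchy development
with complete `𝓘⁺` of an admissible datum carries a Bondi frame foliation canonical for the end whose
final Bondi rest mass dominates `∑ᵢ d.mass i` for every exhaustive `C²` final-state decomposition
(conjecture-strength; not a theorem of the tree). The conclusion is the body of the route decl
`RestMassBudget`, verbatim. Ashtekar–Magnon-Ashtekar 1979; Wald 1984, §11.2.
[cite: AshtekarMagnonAshtekar1979] [cite: Wald1984, §11.2] -/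
theorem of_bondiFrame'
    (hframe : ∀ (X : Type) [TopologicalSpace X] [ChartedSpace E3 X]
      [IsManifold (𝓡 3) ((⊤ : ℕ∞) : WithTop ℕ∞) X] [T2Space X] [SecondCountableTopology X]
      [ConnectedSpace X], ∀ D ∈ admissibleVacuumData X, ∀ (e : AFEnd X) (Madm : ℝ),
      e.IsStronglyAsymptoticallyFlatDR D Madm → ∀ 𝒟 : VacuumCauchyDevelopment D, 𝒟.IsMaximal →
      Summit.FinalStateConjecture.HasCompleteNullInfinity 𝒟.toCauchyDevelopment →
      ∀ (O : Set 𝒟.carrier) (d : FinalStateDecomposition 𝒟.toSpacetime O 2),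
      O = Summit.FinalStateConjecture.exteriorOf 𝒟.toCauchyDevelopment d.charted →
      Summit.FinalStateConjecture.HasExhaustiveCharts d →
      ∃ 𝓕 : 𝒟.toCauchyDevelopment.BondiFrameFoliation,
        𝓕.IsCanonical e ∧ ∑ i, d.mass i ≤ 𝓕.finalBondiRestMass) :
    ∀ (X : Type) [TopologicalSpace X] [ChartedSpace E3 X] [IsManifold (𝓡 3) ((⊤ : ℕ∞) : WithTop ℕ∞) X] [T2Space X] [SecondCountableTopology X] [ConnectedSpace X], ∀ D ∈ admissibleVacuumData X, ∀ (e : AFEnd X) (Madm : ℝ), e.IsStronglyAsymptoticallyFlatDR D Madm → ∀ 𝒟 : VacuumCauchyDevelopment D, 𝒟.IsMaximal → Summit.FinalStateConjecture.HasCompleteNullInfinity 𝒟.toCauchyDevelopment → ∀ (O : Set 𝒟.carrier) (d : FinalStateDecomposition 𝒟.toSpacetime O 2), O = Summit.FinalStateConjecture.exteriorOf 𝒟.toCauchyDevelopment d.charted → Summit.FinalStateConjecture.HasExhaustiveCharts d → ∑ i, d.mass i ≤ Madm :=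
  of_bondiFrame (fun _ _ _ _ _ _ _ _ _ _ _ hSAF ↦ hSAF.hasADMEnergy) hframe

end RestMassBudget

end Summit.FinalStateConjecture.FinalStateConjecture.Theorems

end
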